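import Literature.Geometry.Lorentzian.KerrPhotonShellSphericalOrbits
import HarnessLib

/-!
# The compact window of Kerr labels `(M, a)` and the continuity of `r₊`, `r_ph^±` in the label
(crux `GapExhaustion`, stmt-FinalStateConjecture-10808, line photon-shell-pseudoconvexity;
label-window lemmas UW-0 of the label-uniformity wave of lead c11)

The outward and inward Killing sweeps of the line are proved *uniformly* over a compact set `K`
of Kerr labels `ℓ = (M, a) : ℝ × ℝ` (`ℓ.1 = M`, `ℓ.2 = a`), with band radii
`r_lo, r_hi : ℝ × ℝ → ℝ` continuous on `K`.  The lead instantiates `K` with the label window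
`{m₀ ≤ M ≤ m₀⁻¹, |a| ≤ χ M}` (and with its closed subset on which the photon shell leaves a gap
`r₊ + 2ε ≤ r_ph⁺`), and the radii with `r₊(M, a) + η` and `r_ph⁺(M, a) − ε`.  This file supplies
the five elementary facts feeding the `IsCompact K` / `ContinuousOn r_lo K` hypotheses of the
uniform bricks:

* `isCompact_labelWindow` — the window is compact: closed, and contained in the box
  `[m₀, m₀⁻¹] × [−|χ| m₀⁻¹, |χ| m₀⁻¹]`;
* `continuous_rPlus₂` — `(M, a) ↦ r₊ = M + √(M² − a²)` is continuous;
* `continuousOn_rPhPlus₂`, `continuousOn_rPhMinus₂` — the photon radii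
  `(M, a) ↦ r_ph^± = photonOrbitRadius M (∓|a|) = 4M cos² (⅓ arccos (∓|a| / M))`
  (Bardeen–Press–Teukolsky 1972, §II) are continuous on `{0 < M}` (the only non-global
  ingredient is the quotient `a / M`);
* `isCompact_labelWindowGap` — the gap sub-window `{…, r₊ + 2ε ≤ r_ph⁺}` is compact (a closed
  subset of the window, cut out by functions continuous on it).
-/

noncomputable section

-- D-0017: single-problem summit, `Summit.<S>.<S>.…` by design (cf. lakefile `weak.linter.dupNamespace`).
set_option linter.dupNamespace false

namespace Summit.FinalStateConjecture.FinalStateConjecture.Theorems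

open Set Literature.Geometry.Lorentzian

/-- **The label window `{m₀ ≤ M ≤ m₀⁻¹, |a| ≤ χ M}` is compact** (`0 < m₀`): it is closed, and
`|a| ≤ χ M ≤ |χ| m₀⁻¹` on it, so it lies in the compact box
`[m₀, m₀⁻¹] × [−|χ| m₀⁻¹, |χ| m₀⁻¹]`. [folklore] -/
theorem isCompact_labelWindow (χ m₀ : ℝ) (hm₀ : 0 < m₀) :
    IsCompact {ℓ : ℝ × ℝ | m₀ ≤ ℓ.1 ∧ ℓ.1 ≤ m₀⁻¹ ∧ |ℓ.2| ≤ χ * ℓ.1} := by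
  have hclosed : IsClosed {ℓ : ℝ × ℝ | m₀ ≤ ℓ.1 ∧ ℓ.1 ≤ m₀⁻¹ ∧ |ℓ.2| ≤ χ * ℓ.1} :=
    (isClosed_le continuous_const continuous_fst).inter
      ((isClosed_le continuous_fst continuous_const).inter
        (isClosed_le (continuous_abs.comp continuous_snd) (continuous_const.mul continuous_fst)))
  refine (isCompact_Icc.prod isCompact_Icc :
    IsCompact (Icc m₀ m₀⁻¹ ×ˢ Icc (-(|χ| * m₀⁻¹)) (|χ| * m₀⁻¹))).of_isClosed_subset hclosed ?_
  rintro ⟨M, a⟩ ⟨h₁, h₂, h₃⟩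
  have hM : 0 ≤ M := hm₀.le.trans h₁
  exact mk_mem_prod ⟨h₁, h₂⟩ (abs_le.1 (h₃.trans
    ((mul_le_mul_of_nonneg_right (le_abs_self χ) hM).trans
      (mul_le_mul_of_nonneg_left h₂ (abs_nonneg χ)))))

/-- **`(M, a) ↦ r₊ = M + √(M² − a²)` is continuous** (with the junk value `√` of a negative
number `= 0` beyond extremality built into `Kerr.rPlus`). [folklore] -/
theorem continuous_rPlus₂ : Continuous fun ℓ : ℝ × ℝ => Kerr.rPlus ℓ.1 ℓ.2 := by
  unfold Kerr.rPlus
  fun_prop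

/-- The quotient `(M, b) ↦ b / M` is continuous on `{0 < M}`. [folklore] -/
theorem continuousOn_labelWindow_div {f : ℝ × ℝ → ℝ} (hf : Continuous f) :
    ContinuousOn (fun ℓ : ℝ × ℝ => f ℓ / ℓ.1) {ℓ | 0 < ℓ.1} :=
  hf.continuousOn.div continuousOn_fst fun _ hℓ => ne_of_gt hℓ

/-- The closed form `(M, a) ↦ photonOrbitRadius M (f (M, a)) = (2 √M cos (⅓ arccos (f / M)))²`
is continuous on `{0 < M}` for every continuous `f`. [cite: BardeenPressTeukolsky1972, §II] -/
theorem continuousOn_labelWindow_photonOrbitRadius {f : ℝ × ℝ → ℝ} (hf : Continuous f) :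
    ContinuousOn (fun ℓ : ℝ × ℝ => Kerr.photonOrbitRadius ℓ.1 (f ℓ)) {ℓ | 0 < ℓ.1} := by
  have hg : Continuous fun p : ℝ × ℝ => (2 * √p.1 * Real.cos (Real.arccos p.2 / 3)) ^ 2 := by
    fun_prop
  have hq : ContinuousOn (fun ℓ : ℝ × ℝ => (ℓ.1, f ℓ / ℓ.1)) {ℓ | 0 < ℓ.1} :=
    continuousOn_fst.prodMk (continuousOn_labelWindow_div hf)
  exact hg.comp_continuousOn hq

/-- **`(M, a) ↦ r_ph⁺ = photonOrbitRadius M (−|a|)` (the inner photon radius) is continuous on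
`{0 < M}`.** [cite: BardeenPressTeukolsky1972, §II] -/
theorem continuousOn_rPhPlus₂ :
    ContinuousOn (fun ℓ : ℝ × ℝ => Kerr.photonOrbitRadius ℓ.1 (-|ℓ.2|)) {ℓ | 0 < ℓ.1} :=
  continuousOn_labelWindow_photonOrbitRadius (by fun_prop)

/-- **`(M, a) ↦ r_ph⁻ = photonOrbitRadius M |a|` (the outer photon radius) is continuous on
`{0 < M}`.** [cite: BardeenPressTeukolsky1972, §II] -/
theorem continuousOn_rPhMinus₂ :
    ContinuousOn (fun ℓ : ℝ × ℝ => Kerr.photonOrbitRadius ℓ.1 |ℓ.2|) {ℓ | 0 < ℓ.1} :=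
  continuousOn_labelWindow_photonOrbitRadius (by fun_prop)

/-- **The gap sub-window `{m₀ ≤ M ≤ m₀⁻¹, |a| ≤ χ M, r₊ + 2ε ≤ r_ph⁺}` is compact** (`0 < m₀`):
it is cut out of the compact window by `r₊ + 2ε ≤ r_ph⁺`, both sides continuous on the window
(which lies in `{0 < M}`). [folklore] -/
theorem isCompact_labelWindowGap (χ m₀ ε : ℝ) (hm₀ : 0 < m₀) :
    IsCompact {ℓ : ℝ × ℝ | m₀ ≤ ℓ.1 ∧ ℓ.1 ≤ m₀⁻¹ ∧ |ℓ.2| ≤ χ * ℓ.1 ∧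
      Kerr.rPlus ℓ.1 ℓ.2 + 2 * ε ≤ Kerr.photonOrbitRadius ℓ.1 (-|ℓ.2|)} := by
  have hW := isCompact_labelWindow χ m₀ hm₀
  have hcl : IsClosed {ℓ ∈ {ℓ : ℝ × ℝ | m₀ ≤ ℓ.1 ∧ ℓ.1 ≤ m₀⁻¹ ∧ |ℓ.2| ≤ χ * ℓ.1} |
      Kerr.rPlus ℓ.1 ℓ.2 + 2 * ε ≤ Kerr.photonOrbitRadius ℓ.1 (-|ℓ.2|)} :=
    hW.isClosed.isClosed_le (continuous_rPlus₂.add continuous_const).continuousOn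
      (continuousOn_rPhPlus₂.mono fun _ hℓ => hm₀.trans_le hℓ.1)
  convert hW.of_isClosed_subset hcl (sep_subset _ _) using 1
  ext ℓ
  simp only [mem_setOf_eq, and_assoc]

end Summit.FinalStateConjecture.FinalStateConjecture.Theorems

end
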